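import Mathlib
import Summits.ResolutionOfSingularities.ResolutionOfSingularities.Theorems.WeightedInvariantLocalWeightedDropWildMonicSCleanMax

/-!
# `WeightedInvariant.LocalWeightedDrop`, line `hasse-ridge-face-selection`, S3ρ sub-stub S3ρD `stub_wildMonicSurfaceDescent`:
# MONOMIAL RE-CENTRINGS — coefficients of `shift d A (λ·x^m)` and Perlega's convexity of scaled weights

Crux item stmt-ResolutionOfSingularities-8899 `LocalWeightedDrop` (route `ResolutionOfSingularities/WeightedInvariant`), engine of
the door `HypersurfaceCentreConstruction` stmt-ResolutionOfSingularities-19897.  [OURS · L1 W4.3, chain w43, res-L1-w43-stub-7 (second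
seat on S3ρ under res-type-083); item (C4d) of `L/res-L1-w43-stub-7/S3RHOD-ROADMAP.md` (the secondary cleaning STEP is the monomial
re-centring `y ↦ y + λ·x₁^{a′}x₂^{b}`, Perlega arXiv:2011.14443 Ch. 5 §2.2 Definition; its bookkeeping is Lemma 5.2.4 / 5.2.8).
Nothing here is a statement of H. Hironaka's manuscript [claim: Hironaka2017, status: under-review]; OUR objects.]

* `coeff_shift_monomial` — the coefficient of `x^e` in the slot `i` of `shift d A (monomial m λ)`:
  `[e = (d−i)·m]·C(d,i)·λ^{d−i} + Σ_j [ (j−i)·m ≤ e ]·C(j,i)·λ^{j−i}·coeff_{e − (j−i)·m}(A_j)`;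
* `sub_mul_slotWeight_mul_weight_add` — PERLEGA'S CONVEXITY in scaled form: for `i + n = j`,
  `(d−i)·N_i·w(e″ + n·m) = (d−j)·N_j·w(e″) + n·d!·w(m)` (the reduced point of a product term is the convex combination of the
  reduced points of its factors), and `slotWeight_mul_weight_qOf_smul` (`N_{d−q}·w(q·m) = d!·w(m)`);
* `theta_le_val`, `onSLine_iff_val`, `aboveSLine_iff_val` — «on / strictly above the `s`-line» for a monomial `e` of slot `i` read on the
  SCALED LINE WEIGHT `N_i·w_s(e)` against the level `Θ = s·δ + w_s(r)` (`w_s = (δ!, s)`), for any tuple with prescribed `(δ, r)`;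
  `le_of_conv`, `eq_iff_of_conv` — the two arithmetic consequences of convexity used by Lemma 5.2.8.
-/

set_option linter.dupNamespace false -- mandated namespace of this single-conjunct summit

noncomputable section

namespace Summit.ResolutionOfSingularities.ResolutionOfSingularities.Theorems

namespace WildMonic

open MvPowerSeries MonicDescent

variable {k : Type} [Field k] {d : ℕ}

/-! ## Coefficients of a monomial re-centring -/

section Coeff

variable (A : Fin d → MvPowerSeries (Fin 2) k) (m : Fin 2 →₀ ℕ) (lam : k)

/-- Coefficients of `F · (λ x^m)^n`. -/
theorem coeff_mul_monomial_pow (F : MvPowerSeries (Fin 2) k) (n : ℕ) (e : Fin 2 →₀ ℕ) :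
    coeff e (F * monomial m lam ^ n) = if n • m ≤ e then coeff (e - n • m) F * lam ^ n else 0 := by
  rw [monomial_pow, coeff_mul_monomial]

/-- THE COEFFICIENTS OF A MONOMIAL RE-CENTRING `shift d A (λ·x^m)` (from `shift_eq`, p503865). -/
theorem coeff_shift_monomial (i : Fin d) (e : Fin 2 →₀ ℕ) :
    coeff e (shift d A (monomial m lam) i) =
      (if e = (d - (i : ℕ)) • m then ((d.choose i : ℕ) : k) * lam ^ (d - (i : ℕ)) else 0) +
      ∑ j : Fin d, if ((j : ℕ) - i) • m ≤ e then
        (((j : ℕ).choose i : ℕ) : k) * lam ^ ((j : ℕ) - i) * coeff (e - ((j : ℕ) - i) • m) (A j) else 0 := by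
  classical
  rw [shift_eq, map_add, map_sum]
  congr 1
  · rw [← map_natCast (C : k →+* MvPowerSeries (Fin 2) k), coeff_C_mul, monomial_pow, coeff_monomial]
    split_ifs <;> simp
  · refine Finset.sum_congr rfl fun j _ => ?_
    rw [← map_natCast (C : k →+* MvPowerSeries (Fin 2) k), mul_assoc, coeff_C_mul, coeff_mul_monomial_pow]
    split_ifs <;> ring

end Coeff

/-! ## Convexity of scaled weights -/

section Convex

variable (w : Fin 2 → ℕ) (m : Fin 2 →₀ ℕ)

/-- PERLEGA'S CONVEXITY, scaled: `(d−i)·N_i·w(e″ + n·m) = (d−j)·N_j·w(e″) + n·d!·w(m)` for `i + n = j`. -/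
theorem sub_mul_slotWeight_mul_weight_add (i j : Fin d) (n : ℕ) (hn : (i : ℕ) + n = j) (e'' : Fin 2 →₀ ℕ) :
    (d - (i : ℕ)) * (slotWeight d i * Finsupp.weight w (e'' + n • m)) =
      (d - (j : ℕ)) * (slotWeight d j * Finsupp.weight w e'') + n * (d.factorial * Finsupp.weight w m) := by
  rw [map_add, map_nsmul, smul_eq_mul]
  have h1 := sub_mul_slotWeight i
  have h2 := sub_mul_slotWeight j
  have hj := j.isLt
  obtain ⟨u, hu⟩ : ∃ u, d - (i : ℕ) = u := ⟨_, rfl⟩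
  obtain ⟨v, hv⟩ : ∃ v, d - (j : ℕ) = v := ⟨_, rfl⟩
  have huv : u = v + n := by omega
  rw [hu] at h1 ⊢
  rw [hv] at h2 ⊢
  calc u * (slotWeight d i * (Finsupp.weight w e'' + n * Finsupp.weight w m))
      = (u * slotWeight d i) * Finsupp.weight w e'' + n * ((u * slotWeight d i) * Finsupp.weight w m) := by ring
    _ = (v * slotWeight d j) * Finsupp.weight w e'' + n * (d.factorial * Finsupp.weight w m) := by rw [h1, h2]
    _ = v * (slotWeight d j * Finsupp.weight w e'') + n * (d.factorial * Finsupp.weight w m) := by ring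

/-- The slot `d − q` scales `q`-fold exponents by `d!`: `N_{d−q}·w(q·m) = d!·w(m)`. -/
theorem slotWeight_mul_weight_qOf_smul (p : ℕ) (iq : Fin d) (hiq : (iq : ℕ) = d - qOf p d) :
    slotWeight d iq * Finsupp.weight w (qOf p d • m) = d.factorial * Finsupp.weight w m := by
  rw [map_nsmul, smul_eq_mul, ← mul_assoc]
  congr 1
  have hqd : qOf p d ≤ d := Nat.le_of_dvd (Fin.pos iq) (qOf_dvd p d)
  have h := slotWeight_mul_sub iq
  rwa [show d - (iq : ℕ) = qOf p d by omega] at h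

/-- Arithmetic of convexity, I: `u·V = v·V″ + n·Θ`, `u = v + n`, `Θ ≤ V″` give `Θ ≤ V`. -/
theorem le_of_conv {u v n Θ V V'' : ℕ} (hu : u = v + n) (hupos : 0 < u) (hid : u * V = v * V'' + n * Θ) (hle : Θ ≤ V'') :
    Θ ≤ V := by
  subst hu
  by_contra h
  rw [not_le] at h
  have h1 : (v + n) * V < (v + n) * Θ := Nat.mul_lt_mul_of_pos_left h hupos
  have h2 : v * Θ ≤ v * V'' := Nat.mul_le_mul_left v hle
  rw [hid, add_mul] at h1
  omega

/-- Arithmetic of convexity, II: `u·V = v·V″ + n·Θ`, `u = v + n`, `0 < v` give `V = Θ ↔ V″ = Θ`. -/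
theorem eq_iff_of_conv {u v n Θ V V'' : ℕ} (hu : u = v + n) (hv : 0 < v) (hid : u * V = v * V'' + n * Θ) :
    V = Θ ↔ V'' = Θ := by
  subst hu
  constructor
  · intro h
    rw [h, add_mul] at hid
    have h2 : v * V'' = v * Θ := by omega
    exact Nat.eq_of_mul_eq_mul_left hv h2
  · intro h
    rw [h, ← add_mul] at hid
    exact Nat.eq_of_mul_eq_mul_left (by omega) hid

end Convex

/-! ## The `s`-line on scaled line weights -/

section Line

variable (E : Finset (Fin 2)) (C : Fin d → MvPowerSeries (Fin 2) k) {δ : ℕ} {r : Fin 2 →₀ ℕ}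
  (hδ : dRes E (newtonSet C) = δ) (hr : excExp E (newtonSet C) = r)

include hr in
/-- The scaled line weight of a monomial: `N_i·w_s(e) = (δ!·Q₀ + s·Q₁) + w_s(r)`. -/
theorem slotWeight_mul_weight_line (s : ℕ) (i : Fin d) {e : Fin 2 →₀ ℕ} (he : coeff e (C i) ≠ 0) :
    slotWeight d i * Finsupp.weight ![δ.factorial, s] e =
      δ.factorial * redPt C E i e 0 + s * redPt C E i e 1 + Finsupp.weight ![δ.factorial, s] r := by
  rw [slotWeight_mul_weight E C _ i he, hr, Literature.AlgebraicGeometry.Resolution.WeightedShear.weight_fin_two]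

include hr in
/-- The row of a monomial on the scale: `N_i·e₁ = Q₁ + r₁`. -/
theorem slotWeight_mul_row (i : Fin d) {e : Fin 2 →₀ ℕ} (he : coeff e (C i) ≠ 0) :
    slotWeight d i * e 1 = redPt C E i e 1 + r 1 := by
  have h := redPt_apply_and_le E C i he 1
  rw [hr] at h
  omega

include hδ hr in
/-- ALL MONOMIALS ON OR ABOVE: `s ≤ sFlag` gives `Θ = s·δ + w_s(r) ≤ N_i·w_s(e)`. -/
theorem theta_le_val {s : ℕ} (hs : (s : ℕ∞) ≤ sFlag E (newtonSet C)) (i : Fin d) {e : Fin 2 →₀ ℕ} (he : coeff e (C i) ≠ 0) :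
    s * δ + Finsupp.weight ![δ.factorial, s] r ≤ slotWeight d i * Finsupp.weight ![δ.factorial, s] e := by
  rw [slotWeight_mul_weight_line E C hr s i he]
  have h := (natCast_le_sFlag_iff E C s).1 hs i e he
  rw [hδ] at h
  omega

include hr in
/-- ON THE `s`-LINE in scaled form: `N_i·e₁ < δ + r₁` and `N_i·w_s(e) = Θ`. -/
theorem onSLine_iff_val (s : ℕ) (i : Fin d) {e : Fin 2 →₀ ℕ} (he : coeff e (C i) ≠ 0) :
    OnSLine δ (s : ℕ∞) (redPt C E i e) ↔
      slotWeight d i * e 1 < δ + r 1 ∧ slotWeight d i * Finsupp.weight ![δ.factorial, s] e = s * δ + Finsupp.weight ![δ.factorial, s] r := by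
  rw [onSLine_natCast_iff, slotWeight_mul_weight_line E C hr s i he, slotWeight_mul_row E C hr i he]
  constructor
  · rintro ⟨h1, h2⟩; exact ⟨by omega, by omega⟩
  · rintro ⟨h1, h2⟩; exact ⟨by omega, by omega⟩

include hr in
/-- STRICTLY ABOVE THE `s`-LINE in scaled form: `N_i·e₁ < δ + r₁ → Θ < N_i·w_s(e)`. -/
theorem aboveSLine_iff_val (s : ℕ) (i : Fin d) {e : Fin 2 →₀ ℕ} (he : coeff e (C i) ≠ 0) :
    AboveSLine δ (s : ℕ∞) (redPt C E i e) ↔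
      (slotWeight d i * e 1 < δ + r 1 → s * δ + Finsupp.weight ![δ.factorial, s] r < slotWeight d i * Finsupp.weight ![δ.factorial, s] e) := by
  rw [aboveSLine_natCast_iff, slotWeight_mul_weight_line E C hr s i he, slotWeight_mul_row E C hr i he]
  constructor
  · intro h h1; have := h (by omega); omega
  · intro h h1; have := h (by omega); omega

end Line

end WildMonic

end Summit.ResolutionOfSingularities.ResolutionOfSingularities.Theorems

end
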